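import Summits.Ventures.PackingBounds.Configurations.DesignSlackness

/-!
# `120`-point codes of angle `36°` in `ℝ⁴`: complementary slackness for Andreev's certificate

Framing: lottery ticket; floor = certified bounds/negative ranges. Venture `PackingBounds` (cell
`pub-packcert`, seat `pub-packcert-energy`) — uniqueness of the 600-cell, step 1
(`SixHundredCellCodeCounts`, `SixHundredCellFrame`, `SixHundredCellUnique` follow).

Let `C ⊂ S³` be ANY code with pairwise inner products `≤ (1+√5)/4 = cos 36°` and `|C| = 120` (the maximum:
Andreev 1999; tree `Codes.sixHundredCell_card_le_120`). Andreev's Delsarte certificate `f = Σ_{k ≤ 17} f_k U_k`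
(`andreev`; coefficients in `ℚ(√5)`, re-derived by the cell's recognition pipeline) factors as
`f = P(t) (t - s) q(t)` with `P ≥ 0` vanishing exactly at `-1, 0, ±1/2, ±(√5-1)/4, -(1+√5)/4`, `s = (1+√5)/4`
and `q > 0` on `[-1, s]` (`andreev_sum_eq`, `q_pos`). Complementary slackness
(`DelsarteLP.sum_eq_zero_of_card_mul_eq`) therefore puts every inner product of distinct points of `C` in the
600-cell's set `{±(1+√5)/4, ±1/2, ±(√5-1)/4, 0, -1}` (`inner_mem_of_card_eq_120`), and since
`f_1, …, f_10 > 0` the Gegenbauer moments of orders `1…10` vanish (`moments_of_card_eq_120`): such a code is a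
`10`-design in the moment sense, around every point (`pointMoment_eq_zero`).

## References
* N. N. Andreev, *A spherical code*, Russian Math. Surveys 54 (1999) 251–253. [`Andreev1999`]
* P. Boyvalenkov, D. Danev, *Uniqueness of the 120-point spherical 11-design in four dimensions*,
  Arch. Math. 77 (2001) 360–368.
* H. Cohn, A. Kumar, J. Amer. Math. Soc. 20 (2007) 99–148, Table 1 and Appendix A. [`CohnKumar2006`]
-/

noncomputable section

namespace Summit.Ventures.PackingBounds.Config.SixHundredCellCode

open Finset Literature.Analysis.SpecialFunctions Literature.Geometry.DiscreteGeometry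

/-- `(√5)² = 5` and a rational enclosure. -/
theorem sqrt5_facts : Real.sqrt 5 ^ 2 = 5 ∧ (2.2360679 : ℝ) < Real.sqrt 5 ∧ Real.sqrt 5 < 2.236068 :=
  ⟨Real.sq_sqrt (by norm_num), (Real.lt_sqrt (by norm_num)).mpr (by norm_num),
    (Real.sqrt_lt' (by norm_num)).mpr (by norm_num)⟩

/-- Andreev's certificate: the Gegenbauer (`U_k`) coefficients `f_0, …, f_17`. [cite: Andreev1999, Theorem] -/
def andreev : ℕ → ℝ := fun k => match k with
  | 0 => (1 : ℝ)
  | 1 => (2 : ℝ)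
  | 2 => (((307 : ℝ) / 120) + ((3 : ℝ) / 40) * Real.sqrt 5)
  | 3 => (((59 : ℝ) / 30) + ((3 : ℝ) / 5) * Real.sqrt 5)
  | 4 => (((157 : ℝ) / 40) + ((-9 : ℝ) / 40) * Real.sqrt 5)
  | 5 => (((37 : ℝ) / 30) + ((9 : ℝ) / 10) * Real.sqrt 5)
  | 6 => (((181 : ℝ) / 60) + ((-3 : ℝ) / 20) * Real.sqrt 5)
  | 7 => (((13 : ℝ) / 10) + ((3 : ℝ) / 10) * Real.sqrt 5)
  | 8 => (((31 : ℝ) / 20) + ((-3 : ℝ) / 20) * Real.sqrt 5)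
  | 9 => ((3 : ℝ) / 5)
  | 10 => (((11 : ℝ) / 20) + ((-3 : ℝ) / 20) * Real.sqrt 5)
  | 11 => (0 : ℝ)
  | 12 => (0 : ℝ)
  | 13 => (0 : ℝ)
  | 14 => (((-13 : ℝ) / 120) + ((3 : ℝ) / 40) * Real.sqrt 5)
  | 15 => (((11 : ℝ) / 15) + ((-3 : ℝ) / 10) * Real.sqrt 5)
  | 16 => (((-11 : ℝ) / 24) + ((9 : ℝ) / 40) * Real.sqrt 5)
  | 17 => (((7 : ℝ) / 10) + ((-3 : ℝ) / 10) * Real.sqrt 5)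
  | _ => 0

/-- The nonnegative factor `P(t) = (t+1) t² (t-1/2)² (t+1/2)² (t² + t/2 - 1/4)² (t - (1-√5)/4)²`. -/
def pPart (t : ℝ) : ℝ :=
  (t + 1) * (t ^ 2 * ((t - 1 / 2) ^ 2 * ((t + 1 / 2) ^ 2 * ((t ^ 2 + t / 2 - 1 / 4) ^ 2 *
    (t + (-1 / 4 + Real.sqrt 5 / 4)) ^ 2))))

/-- The cubic cofactor `q(t)`, positive on `[-1, (1+√5)/4]`. -/
def qPart (t : ℝ) : ℝ :=
  (((397312 : ℝ) / 5) + ((-167936 : ℝ) / 5) * Real.sqrt 5) +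
    (((-1122304 : ℝ) / 15) + ((475136 : ℝ) / 15) * Real.sqrt 5) * t ^ 1 +
    (((-286720 : ℝ) / 3) + (40960 : ℝ) * Real.sqrt 5) * t ^ 2 +
    (((458752 : ℝ) / 5) + ((-196608 : ℝ) / 5) * Real.sqrt 5) * t ^ 3

/-- All certificate coefficients are nonnegative. -/
theorem andreev_nonneg (k : ℕ) : 0 ≤ andreev k := by
  obtain ⟨_, hlo, hhi⟩ := sqrt5_facts
  simp only [andreev]
  split <;> linarith [hlo, hhi]

/-- The coefficients `f_1, …, f_10` are strictly positive. -/
theorem andreev_pos {k : ℕ} (hk1 : 1 ≤ k) (hk2 : k ≤ 10) : 0 < andreev k := by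
  obtain ⟨_, hlo, hhi⟩ := sqrt5_facts
  interval_cases k <;> simp only [andreev] <;> linarith [hlo, hhi]

set_option maxHeartbeats 400000 in
/-- **The factorisation of Andreev's polynomial**: `Σ_k f_k U_k(t) = P(t) · ((t - s) q(t))`. -/
theorem andreev_sum_eq (t : ℝ) :
    ∑ k ∈ range (17 + 1), andreev k * gegenbauerSum (1 : ℝ) k t =
      pPart t * ((t - (1 + Real.sqrt 5) / 4) * qPart t) := by
  have hX := sqrt5_facts.1
  simp [andreev, pPart, qPart, Finset.sum_range_succ, gegenbauerSum, gegenbauerCoeff,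
    Finset.prod_range_succ, Nat.factorial]
  linear_combination (((-261 : ℝ) / 20) * t ^ 2 + ((69 : ℝ) / 10) * t ^ 2 * Real.sqrt 5 ^ 1 +
      ((-41 : ℝ) / 20) * t ^ 2 * Real.sqrt 5 ^ 2 + ((1089 : ℝ) / 20) * t ^ 3 +
      ((-177 : ℝ) / 5) * t ^ 3 * Real.sqrt 5 ^ 1 + ((97 : ℝ) / 12) * t ^ 3 * Real.sqrt 5 ^ 2
      + ((3131 : ℝ) / 15) * t ^ 4 + ((-669 : ℝ) / 10) * t ^ 4 * Real.sqrt 5 ^ 1 +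
      ((59 : ℝ) / 2) * t ^ 4 * Real.sqrt 5 ^ 2 + ((-27047 : ℝ) / 30) * t ^ 5 +
      ((2517 : ℝ) / 5) * t ^ 5 * Real.sqrt 5 ^ 1 +
      ((-3439 : ℝ) / 30) * t ^ 5 * Real.sqrt 5 ^ 2 + ((-22988 : ℝ) / 15) * t ^ 6 +
      ((948 : ℝ) / 5) * t ^ 6 * Real.sqrt 5 ^ 1 + ((-964 : ℝ) / 5) * t ^ 6 * Real.sqrt 5 ^ 2
      + ((89614 : ℝ) / 15) * t ^ 7 + ((-14052 : ℝ) / 5) * t ^ 7 * Real.sqrt 5 ^ 1 +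
      ((1822 : ℝ) / 3) * t ^ 7 * Real.sqrt 5 ^ 2 + ((103184 : ℝ) / 15) * t ^ 8 +
      ((-168 : ℝ) / 5) * t ^ 8 * Real.sqrt 5 ^ 1 + ((2200 : ℝ) / 3) * t ^ 8 * Real.sqrt 5 ^ 2
      + ((-300848 : ℝ) / 15) * t ^ 9 + ((39168 : ℝ) / 5) * t ^ 9 * Real.sqrt 5 ^ 1 +
      ((-7312 : ℝ) / 5) * t ^ 9 * Real.sqrt 5 ^ 2 + ((-295648 : ℝ) / 15) * t ^ 10 +
      ((-2784 : ℝ) / 5) * t ^ 10 * Real.sqrt 5 ^ 1 +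
      ((-4736 : ℝ) / 3) * t ^ 10 * Real.sqrt 5 ^ 2 + ((531488 : ℝ) / 15) * t ^ 11 +
      ((-57408 : ℝ) / 5) * t ^ 11 * Real.sqrt 5 ^ 1 +
      ((4640 : ℝ) / 3) * t ^ 11 * Real.sqrt 5 ^ 2 + ((167168 : ℝ) / 5) * t ^ 12 +
      (768 : ℝ) * t ^ 12 * Real.sqrt 5 ^ 1 + ((4864 : ℝ) / 3) * t ^ 12 * Real.sqrt 5 ^ 2 +
      ((-153472 : ℝ) / 5) * t ^ 13 + (8448 : ℝ) * t ^ 13 * Real.sqrt 5 ^ 1 +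
      ((-2944 : ℝ) / 5) * t ^ 13 * Real.sqrt 5 ^ 2 + ((-435712 : ℝ) / 15) * t ^ 14 +
      ((-1536 : ℝ) / 5) * t ^ 14 * Real.sqrt 5 ^ 1 +
      ((-3072 : ℝ) / 5) * t ^ 14 * Real.sqrt 5 ^ 2 + (10240 : ℝ) * t ^ 15 +
      ((-12288 : ℝ) / 5) * t ^ 15 * Real.sqrt 5 ^ 1 + ((49152 : ℝ) / 5) * t ^ 16) * hX

/-- `P(t) ≥ 0`. -/
theorem pPart_nonneg (t : ℝ) : 0 ≤ pPart t ∨ t < -1 := by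
  by_cases ht : -1 ≤ t
  · left
    exact mul_nonneg (by linarith) (mul_nonneg (sq_nonneg _) (mul_nonneg (sq_nonneg _)
      (mul_nonneg (sq_nonneg _) (mul_nonneg (sq_nonneg _) (sq_nonneg _)))))
  · right; linarith

/-- **`q > 0` on `[-1, (1+√5)/4]`.** -/
theorem qPart_pos {t : ℝ} (ht1 : -1 ≤ t) (ht2 : t ≤ (1 + Real.sqrt 5) / 4) : 0 < qPart t := by
  obtain ⟨hX, hlo, hhi⟩ := sqrt5_facts
  have hid : qPart t =
      (((-495616 : ℝ) / 15) + ((45056 : ℝ) / 3) * Real.sqrt 5) + (t + 1) *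
        ((((2637824 : ℝ) / 15) + ((-393216 : ℝ) / 5) * Real.sqrt 5) + (t - (1 + Real.sqrt 5) / 4) *
          ((((458752 : ℝ) / 5) + ((-196608 : ℝ) / 5) * Real.sqrt 5) * t +
            (((-3203072 : ℝ) / 15) + ((466944 : ℝ) / 5) * Real.sqrt 5))) := by
    simp only [qPart]
    linear_combination (((116736 : ℝ) / 5) + ((67584 : ℝ) / 5) * t ^ 1 + ((-49152 : ℝ) / 5) * t ^ 2) * hX
  have hts : t - (1 + Real.sqrt 5) / 4 ≤ 0 := by linarith
  have ha : 0 ≤ (((458752 : ℝ) / 5) + ((-196608 : ℝ) / 5) * Real.sqrt 5) := by linarith [hlo, hhi]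
  have hLs : (((458752 : ℝ) / 5) + ((-196608 : ℝ) / 5) * Real.sqrt 5) * ((1 + Real.sqrt 5) / 4) +
      (((-3203072 : ℝ) / 15) + ((466944 : ℝ) / 5) * Real.sqrt 5) =
      (((-3596288 : ℝ) / 15) + (106496 : ℝ) * Real.sqrt 5) := by
    linear_combination (((-49152 : ℝ) / 5)) * hX
  have hL : (((458752 : ℝ) / 5) + ((-196608 : ℝ) / 5) * Real.sqrt 5) * t +
      (((-3203072 : ℝ) / 15) + ((466944 : ℝ) / 5) * Real.sqrt 5) ≤ 0 := by
    have h := mul_le_mul_of_nonneg_left ht2 ha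
    linarith [hlo, hhi, h, hLs]
  have hprod : 0 ≤ (t - (1 + Real.sqrt 5) / 4) * ((((458752 : ℝ) / 5) +
      ((-196608 : ℝ) / 5) * Real.sqrt 5) * t + (((-3203072 : ℝ) / 15) + ((466944 : ℝ) / 5) * Real.sqrt 5)) :=
    mul_nonneg_of_nonpos_of_nonpos hts hL
  have hQ : 0 ≤ (((2637824 : ℝ) / 15) + ((-393216 : ℝ) / 5) * Real.sqrt 5) := by linarith [hlo, hhi]
  have hq1 : 0 < (((-495616 : ℝ) / 15) + ((45056 : ℝ) / 3) * Real.sqrt 5) := by linarith [hlo, hhi]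
  have ht1' : 0 ≤ t + 1 := by linarith
  rw [hid]
  exact add_pos_of_pos_of_nonneg hq1 (mul_nonneg ht1' (add_nonneg hQ hprod))

/-- The certificate is `≤ 0` on `[-1, (1+√5)/4]`. -/
theorem andreev_sum_nonpos (t : ℝ) (ht1 : -1 ≤ t) (ht2 : t ≤ (1 + Real.sqrt 5) / 4) :
    ∑ k ∈ range (17 + 1), andreev k * gegenbauerSum (1 : ℝ) k t ≤ 0 := by
  rw [andreev_sum_eq]
  have hP : 0 ≤ pPart t := (pPart_nonneg t).resolve_right (by linarith)
  exact mul_nonpos_of_nonneg_of_nonpos hP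
    (mul_nonpos_of_nonpos_of_nonneg (by linarith) (qPart_pos ht1 ht2).le)

/-- The certificate takes the value `120 = 120 · f_0` at `1`. -/
theorem andreev_sum_one : ∑ k ∈ range (17 + 1), andreev k * gegenbauerSum (1 : ℝ) k 1 = 120 := by
  simp [andreev, Finset.sum_range_succ, gegenbauerSum, gegenbauerCoeff, Finset.prod_range_succ, Nat.factorial]
  ring

section config

variable {C : Finset (EuclideanSpace ℝ (Fin 4))} (h1 : ∀ x ∈ C, ‖x‖ = 1)
  (h2 : ∀ x ∈ C, ∀ y ∈ C, x ≠ y → inner ℝ x y ≤ (1 + Real.sqrt 5) / 4) (hN : C.card = 120)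
include h1 h2 hN

/-- **Inner products of a `120`-point code of angle `36°` in `ℝ⁴`** lie in the 600-cell's set
`{(1+√5)/4, 1/2, (√5-1)/4, 0, (1-√5)/4, -1/2, -(1+√5)/4, -1}`. [cite: Andreev1999, Theorem] -/
theorem inner_mem_of_card_eq_120 {x y : EuclideanSpace ℝ (Fin 4)} (hx : x ∈ C) (hy : y ∈ C) (hxy : x ≠ y) :
    inner ℝ x y = (1 + Real.sqrt 5) / 4 ∨ inner ℝ x y = 1 / 2 ∨ inner ℝ x y = (Real.sqrt 5 - 1) / 4 ∨
      inner ℝ x y = 0 ∨ inner ℝ x y = (1 - Real.sqrt 5) / 4 ∨ inner ℝ x y = -1 / 2 ∨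
      inner ℝ x y = -(1 + Real.sqrt 5) / 4 ∨ inner ℝ x y = -1 := by
  obtain ⟨hX, hlo, hhi⟩ := sqrt5_facts
  have h0 := DelsarteLP.sum_eq_zero_of_card_mul_eq (n := 4) (μ := 1) (by norm_num) (by norm_num) 17
    andreev andreev_nonneg ((1 + Real.sqrt 5) / 4) andreev_sum_nonpos C h1 h2 ?_ hx hy hxy
  swap
  · rw [hN, andreev_sum_one]; simp [andreev]
  rw [andreev_sum_eq] at h0
  set t : ℝ := inner ℝ x y with ht
  have htle : t ≤ (1 + Real.sqrt 5) / 4 := h2 x hx y hy hxy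
  have htge : -1 ≤ t := by
    have h := abs_real_inner_le_norm x y
    rw [h1 x hx, h1 y hy, one_mul] at h
    exact (abs_le.mp h).1
  have hq := qPart_pos htge htle
  rcases mul_eq_zero.mp h0 with hP | h
  · -- a root of `P`
    simp only [pPart] at hP
    rcases mul_eq_zero.mp hP with h | h
    · right; right; right; right; right; right; right; linarith
    rcases mul_eq_zero.mp h with h | h
    · right; right; right; left; exact pow_eq_zero_iff two_ne_zero |>.mp h
    rcases mul_eq_zero.mp h with h | h
    · right; left; have := pow_eq_zero_iff two_ne_zero |>.mp h; linarith
    rcases mul_eq_zero.mp h with h | h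
    · right; right; right; right; right; left; have := pow_eq_zero_iff two_ne_zero |>.mp h; linarith
    rcases mul_eq_zero.mp h with h | h
    · have h' := pow_eq_zero_iff two_ne_zero |>.mp h
      -- `t² + t/2 - 1/4 = 0`: `t = (-1 ± √5)/4`
      have hfac : (t - (Real.sqrt 5 - 1) / 4) * (t - (-(1 + Real.sqrt 5)) / 4) = 0 := by
        linear_combination h' + (-1 / 16) * hX
      rcases mul_eq_zero.mp hfac with h'' | h''
      · right; right; left; linarith
      · right; right; right; right; right; right; left; linarith
    · right; right; right; right; left; have := pow_eq_zero_iff two_ne_zero |>.mp h; linarith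
  · rcases mul_eq_zero.mp h with h | h
    · left; linarith
    · exact absurd h hq.ne'

/-- **Design property**: the Gegenbauer moments of orders `1…10` of such a code vanish. [cite: Andreev1999, Theorem] -/
theorem moments_of_card_eq_120 {k : ℕ} (hk1 : 1 ≤ k) (hk2 : k ≤ 10) :
    ∑ x ∈ C, ∑ y ∈ C, gegenbauerSum (1 : ℝ) k (inner ℝ x y) = 0 := by
  classical
  have hinner : ∀ a b : EuclideanSpace ℝ (Fin 4), inner ℝ a b = ∑ j, a j * b j := fun a b => by
    simp [PiLp.inner_apply, mul_comm]
  have key := DelsarteLP.sum_sum_gegenbauerSum_eq_zero_of_card_mul_eq_coord (n := 4) (μ := 1)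
    (by norm_num) (by norm_num) 17 andreev andreev_nonneg ((1 + Real.sqrt 5) / 4) andreev_sum_nonpos
    (ι := C) (fun a j => (a : EuclideanSpace ℝ (Fin 4)) j) ?_ ?_ ?_
    (k := k) (Finset.mem_range.2 (by omega)) hk1 (andreev_pos hk1 hk2)
  · have hco : ∑ x ∈ C, ∑ y ∈ C, gegenbauerSum (1 : ℝ) k (inner ℝ x y) =
        ∑ a : C, ∑ b : C, gegenbauerSum (1 : ℝ) k
          (∑ j, (a : EuclideanSpace ℝ (Fin 4)) j * (b : EuclideanSpace ℝ (Fin 4)) j) := by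
      rw [← Finset.sum_coe_sort C]
      refine Finset.sum_congr rfl fun a _ => ?_
      rw [← Finset.sum_coe_sort C]
      exact Finset.sum_congr rfl fun b _ => by rw [hinner]
    rw [hco]
    exact key
  · intro a
    rw [← EuclideanSpace.real_norm_sq_eq, h1 a a.2, one_pow]
  · intro a b hab
    have hne : (a : EuclideanSpace ℝ (Fin 4)) ≠ b := fun h => hab (Subtype.ext h)
    have h := h2 a a.2 b b.2 hne
    rwa [hinner] at h
  · rw [Fintype.card_coe, hN, andreev_sum_one]; simp [andreev]

/-- Per-point moments: `Σ_{w ∈ C} U_k(⟪x, w⟫) = 0` for `x ∈ C`, `1 ≤ k ≤ 10`. -/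
theorem pointMoment_eq_zero {k : ℕ} (hk1 : 1 ≤ k) (hk2 : k ≤ 10) {x : EuclideanSpace ℝ (Fin 4)}
    (hx : x ∈ C) : ∑ w ∈ C, gegenbauerSum (1 : ℝ) k (inner ℝ x w) = 0 :=
  DesignSlackness.pointMoment_eq_zero_of_total (n := 4) (μ := 1) (by norm_num) (by norm_num) C h1 k
    (moments_of_card_eq_120 h1 h2 hN hk1 hk2) hx

end config

end Summit.Ventures.PackingBounds.Config.SixHundredCellCode

end
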